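import Literature.Claims.NS.Chae2007
import Literature.Analysis.FluidPDE.LerayProfileCalculus
import Literature.Analysis.FluidPDE.ClassicalBKMSupNormContinuation
import HarnessLib

/-!
# Claim skeleton: U. Iotti (2025), «Uniform Boundedness of Homogeneous Incompressible Flows in ℝ³»

Cell `ns-claims` (D-0090 NS-CLAIMS SWEEP), claim **C28b** (sub-row of C28 `Iotti2011`, lineage only), typist
`ns-claims-typist-10` (lanes: refuter-6, referee ref-2 g2, salvage p6, writer-2; sources census-1 / lit-4 g3:
`pub/ns-claims/sources/Iotti2025/`, LOCATORS.md, `v1-pages/`, TeX). UNREFEREED CLAIM under adjudication —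
NOTHING in this file asserts a step: every `Step_k` is a `Prop` (a printed assertion, typed so that
`¬ Step_k` or its vacuity is a kernel statement for `Theorems/SoloRefuteIotti2025.lean`); the only `theorem`s
are the kernel composition of the paper's own implications and plumbing.

Version of record: arXiv:2503.03991 **v1** (2025-03-06, 21 pp.; «4 pages of original work» = §§4–6, pp. 7–10)
= Zenodo 10.5281/zenodo.14977034 [Iotti2025UniformBound]; print page = PDF page. Lineage (CARD §1): arXiv
1107.3403 / 1107.2577 (2011, withdrawn by the author, «crucial sign error in equation 1 page 4») attacked the
same quantity `‖u(t)‖_∞` by a different device.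

## Claimed statements (as printed, p. 3)

* **Theorem 2.2 (NS)** «Let u(x,t) be a solution to (1.2) with initial condition u₀ ∈ H^s(ℝ³) where
  s > 3/2 − 1. Then ‖u(·,t)‖_∞ ≤ ‖u(·,ε)‖_∞ ∀ t ∈ [ε,T*). Hence, the solution u can be extended for all
  t ≥ 0.» (= Theorem 6.1 p. 10, A)–C); (1.2) = Navier–Stokes on ℝ³, f ≡ 0, «μ … a positive constant»;
  any 0 < ε < T*.) Typed: `ClaimedTheoremNS = ClaimedMonotoneNS ∧ ClaimedGlobalNS`.
* **Theorem 2.1 (Euler twin)** «… (1.1) with u₀ ∈ H^s(ℝ³) where s > 3/2 + 2. Then ‖u(·,t)‖_∞ = ‖u₀‖_∞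
  ∀ t ∈ [0,T*). Hence, the solution u can be extended for all t ≥ 0.» (= Theorem 5.1 p. 9.) NOT a Clay
  statement. Typed: `ClaimedTheoremEuler = ClaimedConservedEuler ∧ ClaimedGlobalEuler`.

## Rendering (TODO(general form): data in `H^s`, `s > 1/2` resp. `s > 7/2`)

Data and solutions are rendered in the cell's Beale–Kato–Majda class, REUSED BY NAME from C17
(`Chae2007.IsDatum`: smooth, divergence free, every derivative in `L²` — all Clay data (4) are such;
`Chae2007.IsLocalSolution ν T v₀ u p`: classical solution of `(NS)_ν` on `ℝ³ × [0,T)` from `v₀` with all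
`L²` Sobolev norms bounded on compact sub-intervals; `Chae2007.IsGlobalSolution`; `Chae2007.BlowsUpAt T u`:
the `H³` norm is unbounded on `[0,T)`; `ν = 0` is Euler). The paper's class `C([0,T*); H^s)`, `s > 7/2`
(Lemma 4.1) resp. Kato's `C^∞((0,T*); H^∞)` (p. 10 l. 1) contains these solutions, so every typed Step is an
INSTANCE of the printed one (weaker than print; a kernel refutation refutes the print). `‖·‖_∞` is the
pointwise supremum `supNorm`; `Ω_t` (4.1) is `zeroVort u t = {x | curl (u t) x = 0}`; `D_t` (3.4) is
`∂_t + u·∇` with the one-sided time derivative of the tree (`timeDerivWithin`); `∇p·u` is `⟪gradient (p t) x,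
u t x⟫`.

## Clay delta (reference `ClayVariants.lean`, Δ-axes §3)

Nearest: (A) `clayR3.Regularity`. Δ1 ℝ³ = · Δ2 NS, μ > 0 = (the Euler half is outside Clay) · Δ3 f ≡ 0 = · Δ4
data H^s, s > 1/2 ⊇ Clay (4) (covers more data) · Δ5 Kato's solution continued past every T*; Clay's smoothness
on ℝ³ × [0,∞) and bounded energy (7) follow classically in the class (`clay_of_claimedNS`, the argument of
C17 `Chae2007.clay_of_claimedNS`, PROVED) · Δ6 «extended for all t ≥ 0» = no finite maximal time · Δ7 every
μ > 0. Not a wrong-problem candidate.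

## Step table (k · decl · locator · content; typist's private flags live in the CARD, nothing asserted)

* 1 · `Step_1` · Thm 3.1 (i) p. 3–4 / Thm 3.2 (i) p. 4 + «maximal existence time T*» · local theory with a
  maximal solution: global-or-blow-up dichotomy in the class, every `ν ≥ 0` — BY NAME `Chae2007.Step_1`.
* 2 · `Step_2` · Thm 3.1 (ii) p. 4 (NS) as used p. 10 last line · `lim_{t→T*} ‖u(t)‖_∞ < ∞` ⇒ no blow-up
  at `T*` (`ν > 0`).  `Step_2E` · Thm 3.2 (ii) p. 4 (EULER, stated with the velocity sup-norm) as used p. 9.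
* 3 · `Step_3` · **Lemma 4.1 p. 7–8** «u ⊥ ∇p in ℝ³∖Ω_t» for every solution and every `t ∈ [0,T*)`.
  Its printed proof = `Step_3a` ((4.7): a `θ ∈ C¹(ℝ³∖Ω_t)` with `Δp = ∇θ·ω` exists «by the method of
  characteristics») + `Step_3b` = `Device_asPrinted` (the inference (4.7) ⇒ (4.8) «Taking the divergence of
  (4.4), we find Δp = ∇θ·ω … Consequently … ∇p = u × ∇θ in ℝ³∖Ω_t», typed at the grain printed: for fields
  `v`, `q`, `θ`, the scalar equation `Δq = ∇θ·curl v` on `{curl v ≠ 0}` implies the vector identity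
  `∇q = v × ∇θ` there); `step3_of_device : Step_3a → Step_3b → Step_3` is PROVED (`u·(u × ∇θ) = 0`).
* 4 · `Step_4` · Cor 4.1.1 p. 8 (+ Remark 4.2) · orthogonality on the CLOSURE of `ℝ³∖Ω_t`;
  `step4_of_step3` PROVED (continuity, as printed).
* 5 · `Step_5` · Thm 6.1 A) with (6.1)–(6.3) p. 10 (and Thm 5.1 A) with (5.1) p. 9 at `ν = 0`) · at a point
  where `∇p·u = 0`: `D_t|u|² ≤ μΔ|u|²` (resp. `= 0`): the algebra of (3.1)·u.
* 6 · `Step_6` · Prop 4.2 / Cor 4.2.1 p. 8 · `‖u(t)‖_{∞,Ω_t} ≤ ‖u(t)‖_{∞, cl(ℝ³∖Ω_t)}` (in `Ω_t`, `u = ∇φ`,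
  `|∇φ|²` subharmonic, weak maximum principle), every `ν ≥ 0`.
* 7 · `Step_7` · Thm 6.1 C) p. 10 first sentence · A) on `cl(ℝ³∖Ω_t) × (0,T*)` and B) ⇒ the absolute maximum
  of `|u|²` is non-increasing: `‖u(t)‖_∞ ≤ ‖u(ε)‖_∞`, `ε ≤ t < T*`.  `Step_7E` · Thm 5.1 C) p. 9 · A) (= 0)
  and B) ⇒ `‖u(t)‖_∞ = ‖u₀‖_∞` ((5.2)–(5.3), via Remark 4.2: the sets are transported by the flow map).
* `claim_of_steps : Step_1 → Step_2 → Step_3 → Step_5 → Step_6 → Step_7 → ClaimedTheoremNS` and the variant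
  through the printed proof of Lemma 4.1, `claim_of_steps_device : Step_1 → Step_2 → Step_3a → Step_3b → Step_5
  → Step_6 → Step_7 → ClaimedTheoremNS`; Euler: `claimEuler_of_steps : Step_1 → Step_2E → Step_3 → Step_5 →
  Step_6 → Step_7E → ClaimedTheoremEuler`. All PROVED (the paper's logic composes GIVEN its steps).
* DISCHARGED (D-0026, append-only section at the end; nothing above it changed): `step5_holds : Step_5`,
  `step5E_holds : Step_5E` (pointwise calculus (6.1)–(6.3) / (5.1); 2026-08-27).
* Recorded, off the NS path: `Remark41_transport` ((3.6) p. 6 is stated «for Euler or Navier–Stokes»; Remark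
  4.1/4.2 p. 7: `Ω_t = X(Ω₀,t)` — used by Thm 5.1 C); for `μ > 0` vorticity is not transported).

WHAT THIS IS NOT: not a claim about NS regularity or blow-up; not a claim about any author beyond the typed
locator.
-/

noncomputable section

open Set Function Filter MeasureTheory
open scoped Topology ENNReal NNReal ContDiff Laplacian InnerProductSpace

namespace Literature.Claims.NS.Iotti2025

open Literature.Analysis.FluidPDE
open Literature.Claims.NS.Chae2007 (IsDatum IsLocalSolution IsGlobalSolution BlowsUpAt)

/-! ### Vocabulary (definitions with bodies; nothing asserted) -/

/-- `‖w‖_∞ = sup_x |w(x)|` (p. 3, (2.1)–(2.2)), the pointwise supremum of the Euclidean norm (junk `0` for an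
unbounded field; fields of the class are bounded). [cite: Iotti2025UniformBound, (2.1)–(2.2) p.3] -/
def supNorm (w : EuclideanSpace ℝ (Fin 3) → EuclideanSpace ℝ (Fin 3)) : ℝ :=
  ⨆ x, ‖w x‖

/-- `‖w‖_{∞,A} = sup_{x ∈ A} |w(x)|` (Prop. 4.2, Cor. 4.2.1, Thm 5.1/6.1 B)). [cite: Iotti2025UniformBound, Prop. 4.2 p.8] -/
def supNormOn (A : Set (EuclideanSpace ℝ (Fin 3))) (w : EuclideanSpace ℝ (Fin 3) → EuclideanSpace ℝ (Fin 3)) : ℝ :=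
  ⨆ x : A, ‖w x‖

/-- The zero-vorticity set `Ω_t = {x ∈ ℝ³ : ω(x,t) = 0}`, `ω = curl u` (Definition 1, (4.1) p. 7).
[cite: Iotti2025UniformBound, Def. 1 (4.1) p.7] -/
def zeroVort (u : ℝ → EuclideanSpace ℝ (Fin 3) → EuclideanSpace ℝ (Fin 3)) (t : ℝ) :
    Set (EuclideanSpace ℝ (Fin 3)) :=
  {x | curl (u t) x = 0}

/-- `∇p · u` at `(x,t)` (§2.1 p. 3; (4.2), (4.9) p. 7–8). [cite: Iotti2025UniformBound, (4.9) p.8] -/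
def pressureWork (u : ℝ → EuclideanSpace ℝ (Fin 3) → EuclideanSpace ℝ (Fin 3))
    (p : ℝ → EuclideanSpace ℝ (Fin 3) → ℝ) (t : ℝ) (x : EuclideanSpace ℝ (Fin 3)) : ℝ :=
  ⟪gradient (p t) x, u t x⟫_ℝ

/-- `|u|²(x,t)`. [cite: Iotti2025UniformBound, §2.1 p.3] -/
def speedSq (u : ℝ → EuclideanSpace ℝ (Fin 3) → EuclideanSpace ℝ (Fin 3)) (t : ℝ)
    (x : EuclideanSpace ℝ (Fin 3)) : ℝ :=
  ‖u t x‖ ^ 2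

/-- The material derivative `D_t|u|² = ∂_t|u|² + u·∇|u|²` ((3.4) p. 6) on the time set `S` (one-sided time
derivative within `S`, the tree's `timeDerivWithin`). [cite: Iotti2025UniformBound, (3.4) p.6] -/
def matDerivSpeedSq (S : Set ℝ) (u : ℝ → EuclideanSpace ℝ (Fin 3) → EuclideanSpace ℝ (Fin 3)) (t : ℝ)
    (x : EuclideanSpace ℝ (Fin 3)) : ℝ :=
  timeDerivWithin S (speedSq u) t x + fderiv ℝ (speedSq u t) x (u t x)

/-! ### The claimed theorems (p. 3) -/

/-- (2.2): for every solution of the class, `‖u(·,t)‖_∞ ≤ ‖u(·,ε)‖_∞` for `0 < ε ≤ t < T*` — rendered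
pointwise (`|u(x,t)| ≤ ‖u(ε)‖_∞` for every `x`), every `μ > 0`. [claim: Iotti2025UniformBound, status: disputed] -/
def ClaimedMonotoneNS : Prop :=
  ∀ ν : ℝ, 0 < ν → ∀ T : ℝ, 0 < T →
    ∀ (v₀ : EuclideanSpace ℝ (Fin 3) → EuclideanSpace ℝ (Fin 3))
      (u : ℝ → EuclideanSpace ℝ (Fin 3) → EuclideanSpace ℝ (Fin 3)) (p : ℝ → EuclideanSpace ℝ (Fin 3) → ℝ),
      IsLocalSolution ν T v₀ u p → ∀ ε ∈ Ioo 0 T, ∀ t ∈ Ico ε T, ∀ x, ‖u t x‖ ≤ supNorm (u ε)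

/-- «Hence, the solution u can be extended for all t ≥ 0» (Thm 2.2): every datum of the class launches a
global solution of `(NS)_μ`, every `μ > 0`. [claim: Iotti2025UniformBound, status: disputed] -/
def ClaimedGlobalNS : Prop :=
  ∀ ν : ℝ, 0 < ν → ∀ v₀ : EuclideanSpace ℝ (Fin 3) → EuclideanSpace ℝ (Fin 3), IsDatum v₀ →
    ∃ (u : ℝ → EuclideanSpace ℝ (Fin 3) → EuclideanSpace ℝ (Fin 3)) (p : ℝ → EuclideanSpace ℝ (Fin 3) → ℝ),
      IsGlobalSolution ν v₀ u p

/-- **Theorem 2.2 (p. 3) = Theorem 6.1 (p. 10)**, as printed: monotonicity (2.2) AND global extension.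
[claim: Iotti2025UniformBound, status: disputed] -/
def ClaimedTheoremNS : Prop :=
  ClaimedMonotoneNS ∧ ClaimedGlobalNS

/-- (2.1): for every Euler solution of the class, `‖u(·,t)‖_∞ = ‖u₀‖_∞` on `[0,T*)`.
[claim: Iotti2025UniformBound, status: disputed] -/
def ClaimedConservedEuler : Prop :=
  ∀ T : ℝ, 0 < T →
    ∀ (v₀ : EuclideanSpace ℝ (Fin 3) → EuclideanSpace ℝ (Fin 3))
      (u : ℝ → EuclideanSpace ℝ (Fin 3) → EuclideanSpace ℝ (Fin 3)) (p : ℝ → EuclideanSpace ℝ (Fin 3) → ℝ),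
      IsLocalSolution 0 T v₀ u p → ∀ t ∈ Ico 0 T, supNorm (u t) = supNorm v₀

/-- Theorem 2.1's «extended for all t ≥ 0» for Euler (`ν = 0`). [claim: Iotti2025UniformBound, status: disputed] -/
def ClaimedGlobalEuler : Prop :=
  ∀ v₀ : EuclideanSpace ℝ (Fin 3) → EuclideanSpace ℝ (Fin 3), IsDatum v₀ →
    ∃ (u : ℝ → EuclideanSpace ℝ (Fin 3) → EuclideanSpace ℝ (Fin 3)) (p : ℝ → EuclideanSpace ℝ (Fin 3) → ℝ),
      IsGlobalSolution 0 v₀ u p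

/-- **Theorem 2.1 (p. 3) = Theorem 5.1 (p. 9)** (Euler), as printed. NOT a Clay statement.
[claim: Iotti2025UniformBound, status: disputed] -/
def ClaimedTheoremEuler : Prop :=
  ClaimedConservedEuler ∧ ClaimedGlobalEuler

/-! ### The paper's steps (no assertion) -/

/-- **Step 1 — the local theory with a maximal solution (Thm 3.1 (i) p. 3–4 for NS, Thm 3.2 (i) p. 4 for
Euler; «The maximal existence time T* of the smooth solution»)**: for every `ν ≥ 0` and every datum of the
class, EITHER a global solution exists OR there are a finite `T* > 0` and a solution on `[0,T*)` that blows
up at `T*`. Classical (Kato; Majda–Bertozzi Thm 3.4/Cor 3.2) — BY NAME the cell's `Chae2007.Step_1`.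
[cite: Iotti2025UniformBound, Thm 3.1 (i) p.3–4; Thm 3.2 (i) p.4] -/
def Step_1 : Prop :=
  Chae2007.Step_1

/-- **Step 2 — Thm 3.1 (ii) p. 4 (Navier–Stokes), as used on p. 10: «Since lim_{t→T*} ‖u(t)‖_∞ < ∞, by
Theorem 3.1 (ii), the solution u can be extended for all t ≥ 0»**: a solution on `[0,T)` whose velocity is
uniformly bounded on some `[ε,T) × ℝ³` does not blow up at `T` (`ν > 0`). Classical (`L^∞_t L^∞_x` is a
Prodi–Serrin class). [cite: Iotti2025UniformBound, Thm 3.1 (ii) p.4; p.10 last sentence] -/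
def Step_2 : Prop :=
  ∀ ν : ℝ, 0 < ν → ∀ T : ℝ, 0 < T →
    ∀ (v₀ : EuclideanSpace ℝ (Fin 3) → EuclideanSpace ℝ (Fin 3))
      (u : ℝ → EuclideanSpace ℝ (Fin 3) → EuclideanSpace ℝ (Fin 3)) (p : ℝ → EuclideanSpace ℝ (Fin 3) → ℝ),
      IsLocalSolution ν T v₀ u p →
      (∃ ε ∈ Ioo 0 T, ∃ M : ℝ, ∀ t ∈ Ico ε T, ∀ x, ‖u t x‖ ≤ M) → ¬ BlowsUpAt T u

/-- **Step 2E — Thm 3.2 (ii) p. 4 (EULER): «The maximal existence time T* of the smooth solution u is finite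
if and only if lim_{t→T*} ‖u(t)‖_∞ = ∞»**, as used on p. 9 («Since lim ‖u(t)‖_∞ < ∞, Theorem 3.2 (ii)
guarantees …»): a bounded velocity on `[0,T) × ℝ³` excludes blow-up at `T`, `ν = 0`. (Stated with the
VELOCITY sup-norm; the classical Euler criteria are `∫‖∇u‖_∞` (Thm 3.3) and BKM `∫‖ω‖_∞` (Thm 3.4).)
[claim: Iotti2025UniformBound, status: disputed] -/
def Step_2E : Prop :=
  ∀ T : ℝ, 0 < T →
    ∀ (v₀ : EuclideanSpace ℝ (Fin 3) → EuclideanSpace ℝ (Fin 3))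
      (u : ℝ → EuclideanSpace ℝ (Fin 3) → EuclideanSpace ℝ (Fin 3)) (p : ℝ → EuclideanSpace ℝ (Fin 3) → ℝ),
      IsLocalSolution 0 T v₀ u p → (∃ M : ℝ, ∀ t ∈ Ico 0 T, ∀ x, ‖u t x‖ ≤ M) → ¬ BlowsUpAt T u

/-- **Step 3 — Lemma 4.1 (p. 7): «Let u ∈ C([0,T*); H^s(ℝ³)) for s > 3/2 + 2, solution to (1.2) or (1.1) and
t ∈ [0,T*). Then (4.2) u ⊥ ∇p in ℝ³∖Ω_t»**, i.e. (4.9) `u·∇p = 0` at every point of non-zero vorticity, for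
every solution of the class, every `ν ≥ 0`, every `t ∈ [0,T*)`. [claim: Iotti2025UniformBound, status: disputed] -/
def Step_3 : Prop :=
  ∀ ν : ℝ, 0 ≤ ν → ∀ T : ℝ, 0 < T →
    ∀ (v₀ : EuclideanSpace ℝ (Fin 3) → EuclideanSpace ℝ (Fin 3))
      (u : ℝ → EuclideanSpace ℝ (Fin 3) → EuclideanSpace ℝ (Fin 3)) (p : ℝ → EuclideanSpace ℝ (Fin 3) → ℝ),
      IsLocalSolution ν T v₀ u p → ∀ t ∈ Ico 0 T, ∀ x, curl (u t) x ≠ 0 → pressureWork u p t x = 0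

/-- **Step 3a — (4.7) p. 8, the auxiliary field: «Taking the divergence of (4.4), we find Δp = ∇θ·ω. This is
a non homogeneous first-order linear partial differential equation for θ. Since ω ∈ C¹(ℝ³), Δp ∈ C¹(ℝ³), and
ω ≠ 0 in ℝ³∖Ω_t, with both ω and Δp vanishing at infinity and ω = 0 in ∂Ω_t and Ω_t is a C¹-regular set,
the method of characteristics guarantees the existence of a solution θ ∈ C¹(ℝ³∖Ω_t)»**: for every solution
of the class and every `t ∈ [0,T*)` there is `θ`, `C¹` on the open set `{ω ≠ 0}`, with `Δp = ∇θ·ω` there.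
[claim: Iotti2025UniformBound, status: disputed] -/
def Step_3a : Prop :=
  ∀ ν : ℝ, 0 ≤ ν → ∀ T : ℝ, 0 < T →
    ∀ (v₀ : EuclideanSpace ℝ (Fin 3) → EuclideanSpace ℝ (Fin 3))
      (u : ℝ → EuclideanSpace ℝ (Fin 3) → EuclideanSpace ℝ (Fin 3)) (p : ℝ → EuclideanSpace ℝ (Fin 3) → ℝ),
      IsLocalSolution ν T v₀ u p → ∀ t ∈ Ico 0 T,
        ∃ θ : EuclideanSpace ℝ (Fin 3) → ℝ, ContDiffOn ℝ 1 θ {x | curl (u t) x ≠ 0} ∧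
          ∀ x, curl (u t) x ≠ 0 → Δ (p t) x = ⟪gradient θ x, curl (u t) x⟫_ℝ

/-- **Step 3b = `Device_asPrinted` — the inference (4.7) ⇒ (4.8) of the proof of Lemma 4.1 (p. 7–8), AT THE
GRAIN PRINTED (FAILURE-MODES F15): «To ensure that u ⊥ ∇p, we set (4.3) ∇p = u × ∇θ, where ∇θ is a vector
field to be determined … (4.4) ∇p = u × ∇θ = θω − ∇ × (θu) … Taking the divergence of (4.4), we find (4.7)
Δp = ∇θ·ω … [a solution θ ∈ C¹(ℝ³∖Ω_t) exists] … Consequently, for all t ∈ [0,T*), we have (4.8)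
∇p = u × ∇θ in ℝ³∖Ω_t».** Typed for fields `v ∈ C²` (the velocity slice, `s > 3/2 + 2`), `q ∈ C^∞` (the
pressure slice) and `θ` (`C¹` on `{curl v ≠ 0}`): the scalar equation (4.7) on `{curl v ≠ 0}` implies the
vector identity (4.8) there. The fields are NOT required to solve any equation (the printed inference uses
none). [claim: Iotti2025UniformBound, status: disputed] -/
def Device_asPrinted : Prop :=
  ∀ (v : EuclideanSpace ℝ (Fin 3) → EuclideanSpace ℝ (Fin 3)) (q θ : EuclideanSpace ℝ (Fin 3) → ℝ),
    ContDiff ℝ 2 v → ContDiff ℝ ∞ q → ContDiffOn ℝ 1 θ {x | curl v x ≠ 0} →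
    (∀ x, curl v x ≠ 0 → Δ q x = ⟪gradient θ x, curl v x⟫_ℝ) →
    ∀ x, curl v x ≠ 0 → gradient q x = cross (v x) (gradient θ x)

/-- Step 3b is the printed device. [cite: Iotti2025UniformBound, (4.3)–(4.8) p.7–8] -/
def Step_3b : Prop :=
  Device_asPrinted

/-- **Step 4 — Corollary 4.1.1 (p. 8): «∇p·u = 0 ∀ x ∈ ∂Ω_t» («Since (∇p·u) ∈ C(ℝ³ × [0,T*)), continuity
yields ∇p·u = 0 in ℝ³∖Ω_t ⇒ ∇p·u = 0 in cl(ℝ³∖Ω_t)»), with Remark 4.2**: orthogonality on the closure of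
the non-zero-vorticity set. [claim: Iotti2025UniformBound, status: disputed] -/
def Step_4 : Prop :=
  ∀ ν : ℝ, 0 ≤ ν → ∀ T : ℝ, 0 < T →
    ∀ (v₀ : EuclideanSpace ℝ (Fin 3) → EuclideanSpace ℝ (Fin 3))
      (u : ℝ → EuclideanSpace ℝ (Fin 3) → EuclideanSpace ℝ (Fin 3)) (p : ℝ → EuclideanSpace ℝ (Fin 3) → ℝ),
      IsLocalSolution ν T v₀ u p → ∀ t ∈ Ico 0 T, ∀ x ∈ closure {y | curl (u t) y ≠ 0}, pressureWork u p t x = 0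

/-- **Step 5 — Theorem 6.1 A) with its proof (6.1)–(6.3) p. 10 (and Theorem 5.1 A) with (5.1) p. 9 at
μ = 0): «We start with (3.1) and take the pointwise scalar product with u, yielding (6.1) ½∂_t|u|² =
−½∇|u|²·u + (u × ω)·u − ∇p·u + μΔu·u. … we have ∇p·u = 0 … (6.2) ½D_t|u|² = μΔu·u = μ½Δ|u|² − μ|∇u|², and
thus (6.3) D_t|u|² ≤ μΔ|u|²»** — typed as the implication AT A POINT `(x,t)`, `t ∈ (0,T*)`, where
`∇p·u = 0`: `D_t|u|² ≤ μ Δ|u|²` (for `μ = 0`: `≤ 0`; the Euler equality is `Step_5E`). [cite: Iotti2025UniformBound, (6.1)–(6.3) p.10] -/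
def Step_5 : Prop :=
  ∀ ν : ℝ, 0 ≤ ν → ∀ T : ℝ, 0 < T →
    ∀ (v₀ : EuclideanSpace ℝ (Fin 3) → EuclideanSpace ℝ (Fin 3))
      (u : ℝ → EuclideanSpace ℝ (Fin 3) → EuclideanSpace ℝ (Fin 3)) (p : ℝ → EuclideanSpace ℝ (Fin 3) → ℝ),
      IsLocalSolution ν T v₀ u p → ∀ t ∈ Ioo 0 T, ∀ x, pressureWork u p t x = 0 →
        matDerivSpeedSq (Ico 0 T) u t x ≤ ν * Δ (speedSq u t) x

/-- **Step 5E — Theorem 5.1 A) p. 9 (Euler): «Consequently, D_t|u|² = 0 ∀ (x,t) ∈ cl(ℝ³∖Ω_t) × [0,T*)»**,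
typed at a point where `∇p·u = 0`, `t ∈ [0,T*)`, `ν = 0`. [cite: Iotti2025UniformBound, Thm 5.1 A) and (5.1) p.9] -/
def Step_5E : Prop :=
  ∀ T : ℝ, 0 < T →
    ∀ (v₀ : EuclideanSpace ℝ (Fin 3) → EuclideanSpace ℝ (Fin 3))
      (u : ℝ → EuclideanSpace ℝ (Fin 3) → EuclideanSpace ℝ (Fin 3)) (p : ℝ → EuclideanSpace ℝ (Fin 3) → ℝ),
      IsLocalSolution 0 T v₀ u p → ∀ t ∈ Ico 0 T, ∀ x, pressureWork u p t x = 0 →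
        matDerivSpeedSq (Ico 0 T) u t x = 0

/-- **Step 6 — Proposition 4.2 / Corollary 4.2.1 (p. 8): «In Ω_t, we have ∇ × u = 0, hence there exists a
scalar potential φ such that u = ∇φ. Since ∇·u = 0, φ is harmonic, and (∇φ)² is subharmonic … the weak
maximum principle holds: sup_{Ω_t}|u|² ≤ sup_{∂Ω_t}|u|²»; «‖u(·,t)‖_{∞,Ω_t} ≤ ‖u(·,t)‖_{∞, cl(ℝ³∖Ω_t)} for
t ∈ [0,T*)»** = Thm 5.1/6.1 B): rendered pointwise — every value `|u(x,t)|` is bounded by the supremum over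
the closure of the non-zero-vorticity set; every `ν ≥ 0`. [claim: Iotti2025UniformBound, status: disputed] -/
def Step_6 : Prop :=
  ∀ ν : ℝ, 0 ≤ ν → ∀ T : ℝ, 0 < T →
    ∀ (v₀ : EuclideanSpace ℝ (Fin 3) → EuclideanSpace ℝ (Fin 3))
      (u : ℝ → EuclideanSpace ℝ (Fin 3) → EuclideanSpace ℝ (Fin 3)) (p : ℝ → EuclideanSpace ℝ (Fin 3) → ℝ),
      IsLocalSolution ν T v₀ u p → ∀ t ∈ Ico 0 T, ∀ x,
        ‖u t x‖ ≤ supNormOn (closure {y | curl (u t) y ≠ 0}) (u t)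

/-- **Step 7 — Theorem 6.1 C), first sentence (p. 10): «By point (A), |u|² is a sub-solution in
cl(ℝ³∖Ω_t) × (0,T*). Consequently, the weak parabolic maximum principle applies, and for all t ∈ (0,T*),
the points where |u(x,t)|² attains its absolute maximum lie on ∂(ℝ³∖Ω_t) ∩ ∂Ω_t and absolute maximum is
non-increasing with respect to t. This leads to (6.4) … Moreover, by (B), we have (6.5) ‖u(·,t)‖_∞ ≤
‖u(·,ε)‖_∞ ∀ t ∈ [ε,T*)»**: A) on the closure × (0,T*) and B) imply the monotonicity, `ν > 0` — rendered
pointwise. [claim: Iotti2025UniformBound, status: disputed] -/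
def Step_7 : Prop :=
  ∀ ν : ℝ, 0 < ν → ∀ T : ℝ, 0 < T →
    ∀ (v₀ : EuclideanSpace ℝ (Fin 3) → EuclideanSpace ℝ (Fin 3))
      (u : ℝ → EuclideanSpace ℝ (Fin 3) → EuclideanSpace ℝ (Fin 3)) (p : ℝ → EuclideanSpace ℝ (Fin 3) → ℝ),
      IsLocalSolution ν T v₀ u p →
      (∀ t ∈ Ioo 0 T, ∀ x ∈ closure {y | curl (u t) y ≠ 0},
          matDerivSpeedSq (Ico 0 T) u t x ≤ ν * Δ (speedSq u t) x) →
      (∀ t ∈ Ico 0 T, ∀ x, ‖u t x‖ ≤ supNormOn (closure {y | curl (u t) y ≠ 0}) (u t)) →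
      ∀ ε ∈ Ioo 0 T, ∀ t ∈ Ico ε T, ∀ x, ‖u t x‖ ≤ supNorm (u ε)

/-- **Step 7E — Theorem 5.1 C) (p. 9): «By point (A), energy is constant along all streamlines in
cl(ℝ³∖Ω_t) × [0,T*). This leads to (5.2) ‖u(·,t)‖_{∞,cl(ℝ³∖Ω_t)} = ‖u₀‖_{∞,cl(ℝ³∖Ω₀)} ∀ t ∈ [0,T*).
Moreover, (B) ensures that (5.3) ‖u(·,t)‖_∞ = ‖u₀‖_∞»** (through Remark 4.2: `cl(ℝ³∖Ω_t)` is transported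
by the flow map), `ν = 0`. [claim: Iotti2025UniformBound, status: disputed] -/
def Step_7E : Prop :=
  ∀ T : ℝ, 0 < T →
    ∀ (v₀ : EuclideanSpace ℝ (Fin 3) → EuclideanSpace ℝ (Fin 3))
      (u : ℝ → EuclideanSpace ℝ (Fin 3) → EuclideanSpace ℝ (Fin 3)) (p : ℝ → EuclideanSpace ℝ (Fin 3) → ℝ),
      IsLocalSolution 0 T v₀ u p →
      (∀ t ∈ Ico 0 T, ∀ x ∈ closure {y | curl (u t) y ≠ 0}, matDerivSpeedSq (Ico 0 T) u t x = 0) →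
      (∀ t ∈ Ico 0 T, ∀ x, ‖u t x‖ ≤ supNormOn (closure {y | curl (u t) y ≠ 0}) (u t)) →
      ∀ t ∈ Ico 0 T, (∀ x, ‖u t x‖ ≤ supNorm v₀) ∧ supNorm (u t) = supNorm v₀

/-- **Recorded, off the Navier–Stokes path — (3.6) p. 6 and Remark 4.1 p. 7: «A fundamental result is the
vorticity transport formula … ω(X(α,t),t) = ∇_αX(α,t) ω₀(α)» stated for «a velocity field solving the Euler
(1.1) or Navier–Stokes (1.2) equations»; «By (3.6), the sets Ω_t are mutually diffeomorphic … Ω_t =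
X(Ω₀,t)».** Rendered at the zero-set grain for a solution of `(NS)_ν`, `ν ≥ 0`, along any trajectory
`X' = u(X,t)`: `ω₀(X(0)) = 0 ↔ ω(X(t),t) = 0`. (True for `ν = 0`; consumed only by `Step_7E`'s printed
justification, not by the typed chain.) [claim: Iotti2025UniformBound, status: disputed] -/
def Remark41_transport : Prop :=
  ∀ ν : ℝ, 0 ≤ ν → ∀ T : ℝ, 0 < T →
    ∀ (v₀ : EuclideanSpace ℝ (Fin 3) → EuclideanSpace ℝ (Fin 3))
      (u : ℝ → EuclideanSpace ℝ (Fin 3) → EuclideanSpace ℝ (Fin 3)) (p : ℝ → EuclideanSpace ℝ (Fin 3) → ℝ),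
      IsLocalSolution ν T v₀ u p →
      ∀ X : ℝ → EuclideanSpace ℝ (Fin 3), (∀ t ∈ Ico 0 T, HasDerivWithinAt X (u t (X t)) (Ico 0 T) t) →
        ∀ t ∈ Ico 0 T, (curl v₀ (X 0) = 0 ↔ curl (u t) (X t) = 0)

/-! ### Kernel compositions (the paper's own implications; PROVED) -/

/-- `u · (u × g) = 0` in `ℝ³` (plumbing). [folklore] -/
private theorem inner_cross_self_left (a b : EuclideanSpace ℝ (Fin 3)) : ⟪cross a b, a⟫_ℝ = 0 := by
  simp only [cross, PiLp.inner_apply, RCLike.inner_apply, conj_trivial, Fin.sum_univ_three]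
  simp [crossProduct]
  ring

/-- **Lemma 4.1 from its printed proof**: the auxiliary field (4.7) and the device (4.7) ⇒ (4.8) give
`∇p = u × ∇θ` at every point of non-zero vorticity, hence (4.9) `u·∇p = u·(u × ∇θ) = 0`.
[cite: Iotti2025UniformBound, proof of Lemma 4.1 p.7–8] -/
theorem step3_of_device (h3a : Step_3a) (h3b : Step_3b) : Step_3 := by
  intro ν hν T hT v₀ u p hsol t ht x hx
  obtain ⟨θ, hθ, h47⟩ := h3a ν hν T hT v₀ u p hsol t ht
  have hu2 : ContDiff ℝ 2 (u t) := (hsol.isClassical.contDiff_velocity ht).of_le (by norm_cast)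
  have hp : ContDiff ℝ ∞ (p t) := hsol.isClassical.contDiff_pressure ht
  have h48 := h3b (u t) (p t) θ hu2 hp hθ h47 x hx
  unfold pressureWork
  rw [h48]
  exact inner_cross_self_left _ _

/-- **Corollary 4.1.1 from Lemma 4.1 by continuity** (as printed): `∇p·u` is continuous and vanishes on
`{ω ≠ 0}`, hence on its closure. [cite: Iotti2025UniformBound, Cor. 4.1.1 p.8] -/
theorem step4_of_step3 (h3 : Step_3) : Step_4 := by
  intro ν hν T hT v₀ u p hsol t ht x hx
  have hcu : Continuous (u t) := (hsol.isClassical.contDiff_velocity ht).continuous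
  have hF : Continuous fun y => fderiv ℝ (p t) y :=
    (hsol.isClassical.contDiff_pressure ht).continuous_fderiv (by norm_cast)
  have hg : Continuous fun y => gradient (p t) y := by
    change Continuous fun y => (InnerProductSpace.toDual ℝ (EuclideanSpace ℝ (Fin 3))).symm (fderiv ℝ (p t) y)
    exact (InnerProductSpace.toDual ℝ (EuclideanSpace ℝ (Fin 3))).symm.continuous.comp hF
  have hcont : Continuous fun y => pressureWork u p t y := by
    unfold pressureWork
    exact hg.inner hcu
  have hclosed : IsClosed {y | pressureWork u p t y = 0} := isClosed_eq hcont continuous_const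
  have hsub : {y | curl (u t) y ≠ 0} ⊆ {y | pressureWork u p t y = 0} :=
    fun y hy => h3 ν hν T hT v₀ u p hsol t ht y hy
  exact closure_minimal hsub hclosed hx

/-- **Theorem 6.1 = Theorem 2.2 from the paper's steps** (p. 10): Step 1 gives a maximal solution; Lemma 4.1
(Step 3) and its Corollary 4.1.1 (Step 4, derived) give `∇p·u = 0` on `cl(ℝ³∖Ω_t)`; Step 5 turns it into
A); Step 6 is B); Step 7 gives C) = (2.2); and C) feeds Thm 3.1 (ii) (Step 2), excluding every finite
maximal time. [cite: Iotti2025UniformBound, proof of Thm 6.1 p.10] -/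
theorem claim_of_steps (h1 : Step_1) (h2 : Step_2) (h3 : Step_3) (h5 : Step_5) (h6 : Step_6) (h7 : Step_7) :
    ClaimedTheoremNS := by
  have h4 : Step_4 := step4_of_step3 h3
  -- (2.2) for every local solution
  have hmono : ClaimedMonotoneNS := by
    intro ν hν T hT v₀ u p hsol ε hε t ht x
    refine h7 ν hν T hT v₀ u p hsol ?_ (h6 ν hν.le T hT v₀ u p hsol) ε hε t ht x
    intro s hs y hy
    exact h5 ν hν.le T hT v₀ u p hsol s hs y (h4 ν hν.le T hT v₀ u p hsol s ⟨hs.1.le, hs.2⟩ y hy)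
  refine ⟨hmono, ?_⟩
  intro ν hν v₀ hv₀
  rcases h1 ν hν.le v₀ hv₀ with hglob | ⟨T, hT, u, p, hsol, hblow⟩
  · exact hglob
  · exfalso
    refine h2 ν hν T hT v₀ u p hsol ?_ hblow
    refine ⟨T / 2, ⟨by linarith, by linarith⟩, supNorm (u (T / 2)), fun t ht x => ?_⟩
    exact hmono ν hν T hT v₀ u p hsol (T / 2) ⟨by linarith, by linarith⟩ t ht x

/-- The same composition through the PRINTED PROOF of Lemma 4.1 (Steps 3a, 3b in place of Step 3).
[cite: Iotti2025UniformBound, proof of Lemma 4.1 p.7–8; proof of Thm 6.1 p.10] -/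
theorem claim_of_steps_device (h1 : Step_1) (h2 : Step_2) (h3a : Step_3a) (h3b : Step_3b) (h5 : Step_5)
    (h6 : Step_6) (h7 : Step_7) : ClaimedTheoremNS :=
  claim_of_steps h1 h2 (step3_of_device h3a h3b) h5 h6 h7

/-- **Theorem 5.1 = Theorem 2.1 (Euler) from the paper's steps** (p. 9): Step 1 (ν = 0), Lemma 4.1 and
Cor 4.1.1, A) (Step 5E), B) (Step 6), C) (Step 7E) = (2.1), and Thm 3.2 (ii) (Step 2E).
[cite: Iotti2025UniformBound, proof of Thm 5.1 p.9] -/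
theorem claimEuler_of_steps (h1 : Step_1) (h2 : Step_2E) (h3 : Step_3) (h5 : Step_5E) (h6 : Step_6)
    (h7 : Step_7E) : ClaimedTheoremEuler := by
  have h4 : Step_4 := step4_of_step3 h3
  have hC : ∀ T : ℝ, 0 < T → ∀ v₀ u p, IsLocalSolution 0 T v₀ u p →
      ∀ t ∈ Ico 0 T, (∀ x, ‖u t x‖ ≤ supNorm v₀) ∧ supNorm (u t) = supNorm v₀ := by
    intro T hT v₀ u p hsol
    refine h7 T hT v₀ u p hsol ?_ (h6 0 le_rfl T hT v₀ u p hsol)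
    intro s hs y hy
    exact h5 T hT v₀ u p hsol s hs y (h4 0 le_rfl T hT v₀ u p hsol s hs y hy)
  refine ⟨fun T hT v₀ u p hsol t ht => (hC T hT v₀ u p hsol t ht).2, ?_⟩
  intro v₀ hv₀
  rcases h1 0 le_rfl v₀ hv₀ with hglob | ⟨T, hT, u, p, hsol, hblow⟩
  · exact hglob
  · exfalso
    exact h2 T hT v₀ u p hsol ⟨supNorm v₀, fun t ht x => (hC T hT v₀ u p hsol t ht).1 x⟩ hblow

/-! ### Clay link -/

/-- **Theorem 2.2's global-existence clause implies Clay (A)** (`ClayVariants.clayR3.Regularity`, token for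
token the summit body): a Clay datum (smooth, divergence free, rapid decay (4)) is a datum of the class
(Schwartz ⇒ `H^∞`); the global solution of the class is smooth on `ℝ³ × [0,∞)` with `u(0) = u₀`
(`isNavierStokesSolution_and_smooth_iff`), and the energy bound (7) holds with `C = ∫|u₀|²` by the energy
inequality in the BKM class (`IsClassicalNSSolutionOn.bkm_energy_le`) — the argument of C17
`Chae2007.clay_of_claimedNS`, repeated for the existence-only statement.
[cite: FeffermanClay2006, statement (A), CMI offprint p. 2] -/
theorem clay_of_claimedGlobalNS (h : ClaimedGlobalNS) : ClayVariants.clayR3.Regularity := by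
  intro ν hν u₀ hu₀ hdiv hdecay
  have hdat : IsDatum u₀ :=
    ⟨hu₀, fun x => hdiv x, fun n => hdecay.lintegral_enorm_iteratedFDeriv_sq_lt_top n⟩
  obtain ⟨u, p, hsol⟩ := h ν hν u₀ hdat
  obtain ⟨hns, hsu, hsp⟩ :=
    (isNavierStokesSolution_and_smooth_iff (ν := ν) (f := 0) (u₀ := u₀) (u := u) (p := p)).2
      ⟨hsol.isClassical, hsol.initial⟩
  refine ⟨u, p, hsu, hsp, hns, ?_⟩
  show HasBoundedEnergy u
  have key : ∀ S : ℝ, 0 < S → ∀ τ ∈ Icc (0:ℝ) S,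
      ∫⁻ x, ‖u τ x‖ₑ ^ 2 = ENNReal.ofReal (∫ x, ‖u τ x‖ ^ 2) := by
    intro S hS τ hτ
    have hcl : IsClassicalNSSolutionOn (Icc 0 S) ν 0 u p :=
      hsol.isClassical.mono Icc_subset_Ici_self (uniqueDiffOn_Icc hS)
    obtain ⟨C, hC⟩ := hsol.sobolev S 0
    have hfin0 : ∫⁻ x, ‖iteratedFDeriv ℝ 0 (u τ) x‖ₑ ^ 2 < ⊤ := (hC τ hτ).trans_lt ENNReal.coe_lt_top
    have heq : (fun x => ‖iteratedFDeriv ℝ 0 (u τ) x‖ₑ ^ 2) = fun x => ‖u τ x‖ₑ ^ 2 := by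
      funext x
      rw [← ofReal_norm, norm_iteratedFDeriv_zero, ofReal_norm]
    have hfin : ∫⁻ x, ‖u τ x‖ₑ ^ 2 < ⊤ := by rwa [heq] at hfin0
    have hint : Integrable (fun x => ‖u τ x‖ ^ 2) :=
      integrable_sq_norm_of_lintegral_lt_top (hcl.contDiff_velocity hτ).continuous hfin
    rw [ofReal_integral_eq_lintegral_ofReal hint (Eventually.of_forall fun x => sq_nonneg _)]
    refine lintegral_congr fun x => ?_
    rw [← ofReal_norm, ENNReal.ofReal_pow (norm_nonneg _)]
  refine ⟨∫⁻ x, ‖u₀ x‖ₑ ^ 2, ?_, fun t ht => ?_⟩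
  · have h0 := hdat.2.2 0
    have heq : (fun x => ‖iteratedFDeriv ℝ 0 u₀ x‖ₑ ^ 2) = fun x => ‖u₀ x‖ₑ ^ 2 := by
      funext x
      rw [← ofReal_norm, norm_iteratedFDeriv_zero, ofReal_norm]
    rwa [heq] at h0
  · have hT : (0:ℝ) < t + 1 := by linarith
    have hcl : IsClassicalNSSolutionOn (Icc 0 (t + 1)) ν 0 u p :=
      hsol.isClassical.mono Icc_subset_Ici_self (uniqueDiffOn_Icc hT)
    have hE : ∫ x, ‖u t x‖ ^ 2 ≤ ∫ x, ‖u 0 x‖ ^ 2 :=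
      hcl.bkm_energy_le hν.le hT (hsol.sobolev (t + 1)) ⟨ht, by linarith⟩
    rw [key (t + 1) hT t ⟨ht, by linarith⟩, ← hsol.initial, key (t + 1) hT 0 ⟨le_rfl, hT.le⟩]
    exact ENNReal.ofReal_le_ofReal hE

/-- Theorem 2.2 implies Clay (A). [cite: FeffermanClay2006, statement (A), CMI offprint p. 2] -/
theorem clay_of_claimedNS (h : ClaimedTheoremNS) : ClayVariants.clayR3.Regularity :=
  clay_of_claimedGlobalNS h.2

/-! ### Discharges (D-0026 debt pass, ns-claims-typist-10 g4, 2026-08-27; APPEND-ONLY — no statement,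
definition, locator or class above is touched; #43's locator (Lemma 4.1) stands) -/

/-- **(6.1) p. 10 / (5.1) p. 9, the algebra of `(3.1)·u`, kernel form**: for a classical solution of
`(NS)_ν` on `ℝ³ × [0,T)` (no force), at every `(x,t)`,
`D_t|u|² = ∂_t|u|² + u·∇|u|² = 2⟪u, ∂_t u + (u·∇)u⟫ = 2ν⟪Δu, u⟫ − 2 ∇p·u`.
[cite: Iotti2025UniformBound, (6.1) p.10] -/
theorem matDerivSpeedSq_eq {ν T : ℝ}
    {u : ℝ → EuclideanSpace ℝ (Fin 3) → EuclideanSpace ℝ (Fin 3)} {p : ℝ → EuclideanSpace ℝ (Fin 3) → ℝ}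
    (h : IsClassicalNSSolutionOn (Ico 0 T) ν 0 u p) {t : ℝ} (ht : t ∈ Ico 0 T)
    (x : EuclideanSpace ℝ (Fin 3)) :
    matDerivSpeedSq (Ico 0 T) u t x = 2 * ν * ⟪(Δ (u t)) x, u t x⟫_ℝ - 2 * pressureWork u p t x := by
  -- time part: `∂_t |u|² = 2⟪u, ∂_t u⟫` (one-sided within `[0,T)`)
  have hline : HasDerivWithinAt (fun s => u s x) (timeDerivWithin (Ico 0 T) u t x) (Ico 0 T) t :=
    (h.smooth_velocity.differentiableWithinAt_time ht x).hasDerivWithinAt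
  have htime : timeDerivWithin (Ico 0 T) (speedSq u) t x
      = 2 * ⟪u t x, timeDerivWithin (Ico 0 T) u t x⟫_ℝ := by
    have h2 := hline.norm_sq
    rw [timeDerivWithin_apply]
    exact h2.derivWithin (uniqueDiffOn_Ico 0 T t ht)
  -- space part: `u·∇|u|² = 2⟪u, (u·∇)u⟫`
  have hud : DifferentiableAt ℝ (u t) x :=
    (h.contDiff_velocity ht).differentiable (by simp) x
  have hspace : fderiv ℝ (speedSq u t) x (u t x) = 2 * ⟪u t x, convect (u t) (u t) x⟫_ℝ := by
    have h2 := hud.hasFDerivAt.norm_sq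
    have : speedSq u t = (‖u t ·‖ ^ 2) := rfl
    rw [this, h2.fderiv]
    simp [convect]
  -- momentum `(3.1)·u`
  have hmom := h.momentum t ht x
  simp only [Pi.zero_apply, add_zero] at hmom
  unfold matDerivSpeedSq pressureWork
  rw [htime, hspace, ← mul_add, ← inner_add_right, hmom, inner_sub_right, inner_smul_right]
  have e1 : ⟪u t x, (Δ (u t)) x⟫_ℝ = ⟪(Δ (u t)) x, u t x⟫_ℝ := real_inner_comm _ _
  have e2 : ⟪u t x, gradient (p t) x⟫_ℝ = ⟪gradient (p t) x, u t x⟫_ℝ := real_inner_comm _ _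
  rw [e1, e2]
  ring

/-- **`Δ|u|² = 2⟪Δu, u⟫ + 2|∇u|²`** at every point, for the velocity slice of a classical solution
(the identity behind (6.2) p. 10: `μΔu·u = μ½Δ|u|² − μ|∇u|²`). [cite: Iotti2025UniformBound, (6.2) p.10] -/
theorem laplacian_speedSq_eq {ν T : ℝ}
    {u : ℝ → EuclideanSpace ℝ (Fin 3) → EuclideanSpace ℝ (Fin 3)} {p : ℝ → EuclideanSpace ℝ (Fin 3) → ℝ}
    (h : IsClassicalNSSolutionOn (Ico 0 T) ν 0 u p) {t : ℝ} (ht : t ∈ Ico 0 T)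
    (x : EuclideanSpace ℝ (Fin 3)) :
    Δ (speedSq u t) x = 2 * ⟪(Δ (u t)) x, u t x⟫_ℝ + 2 * frobeniusNormSq (fderiv ℝ (u t) x) := by
  have hu2 : ContDiff ℝ 2 (u t) := (h.contDiff_velocity ht).of_le (by norm_cast)
  have hfun : speedSq u t = fun y => ⟪u t y, u t y⟫_ℝ := by
    funext y
    simp [speedSq]
  rw [hfun]
  exact laplacian_inner_self_eq hu2 x

/-- **Step 5 holds** — Thm 6.1 A) with (6.1)–(6.3) p. 10: at a point where `∇p·u = 0`,
`D_t|u|² = 2μ⟪Δu, u⟫ = μΔ|u|² − 2μ|∇u|² ≤ μΔ|u|²` (`μ ≥ 0`). True pointwise calculus for every classical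
solution; C28b's locator (Lemma 4.1, the hypothesis `∇p·u = 0` itself) is untouched.
[cite: Iotti2025UniformBound, Thm 6.1 A), (6.1)–(6.3) p.10] -/
theorem step5_holds : Step_5 := by
  intro ν hν T hT v₀ u p hsol t ht x hpw
  have ht' : t ∈ Ico 0 T := ⟨ht.1.le, ht.2⟩
  rw [matDerivSpeedSq_eq hsol.isClassical ht' x, laplacian_speedSq_eq hsol.isClassical ht' x, hpw]
  have hfrob : 0 ≤ frobeniusNormSq (fderiv ℝ (u t) x) := frobeniusNormSq_nonneg _
  nlinarith

/-- **Step 5E holds** — Thm 5.1 A) with (5.1) p. 9 (Euler, `μ = 0`): at a point where `∇p·u = 0`,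
`D_t|u|² = −2∇p·u = 0`. True pointwise calculus. [cite: Iotti2025UniformBound, Thm 5.1 A), (5.1) p.9] -/
theorem step5E_holds : Step_5E := by
  intro T hT v₀ u p hsol t ht x hpw
  rw [matDerivSpeedSq_eq hsol.isClassical ht x, hpw]
  ring

/-! #### Discharge of Step 1 (D-0026; the tree's BKM-class maximal-solution theorem) -/

/-- **Step 1 holds** (Thm 3.1 (i) p. 4 as used on p. 10: local existence of a smooth solution in the class of
record, maximal or global): `Step_1` is by definition `Chae2007.Step_1`, now a tree theorem
(`Chae2007.step_1_holds`, assembled from the discharged Majda–Bertozzi 2002 local existence / uniqueness /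
Cor. 3.2 / BKM facts via `Literature.Analysis.FluidPDE.exists_global_bkmClass_or_blowup`). Upstream of C28b's
locator `Step_3b`; nothing above is touched. [cite: Iotti2025UniformBound, Thm 3.1 (i) p.3–4; p.10] -/
theorem step1_holds : Step_1 :=
  Chae2007.step_1_holds

/-! #### Discharge of Step 2 (D-0026; Literature-side twin of the Summits-side
`Summit.NavierStokesRegularity.NavierStokesRegularity.Theorems.Iotti2025.step2_holds`, p514430 — a genuine
restatement: a Literature module cannot import `Summits`, so the fact is re-proved here where it is declared) -/

/-- **Step 2 holds** (Thm 3.1 (ii) p. 4 as used on p. 10: a solution of the class whose velocity is uniformly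
bounded on some `[ε,T) × ℝ³` does not blow up at `T`, `ν > 0`) — the Serrin `L^∞_tL^∞_x` endpoint in the
Beale–Kato–Majda class, i.e. the tree's `hasBoundedSobolevNormsOn_Ico_of_norm_le_near`
(`ClassicalBKMSupNormContinuation.lean`: Leray's structure theorem + Tao's persistence + Sobolev uniqueness), whose
four lowest Sobolev bounds on `[0,T)` contradict `BlowsUpAt T u`. Twin (same statement) of
`Summit.NavierStokesRegularity.NavierStokesRegularity.Theorems.Iotti2025.step2_holds` (salvage lane, p514430).
Upstream of C28b's locator `Step_3b`; nothing above is touched. [cite: Iotti2025UniformBound, Thm 3.1 (ii) p.4; p.10] -/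
theorem step2_holds : Step_2 := by
  intro ν hν T hT v₀ u p hsol hbd hblow
  obtain ⟨ε, hε, M, hM⟩ := hbd
  have hB : HasBoundedSobolevNormsOn (Ico 0 T) u :=
    hasBoundedSobolevNormsOn_Ico_of_norm_le_near hν hT hsol.isClassical hsol.sobolev hε hM
  choose C hC using hB
  refine hblow ⟨∑ n ∈ Finset.range 4, C n, fun t ht => ?_⟩
  push_cast
  exact Finset.sum_le_sum fun n _ => hC n t ht

end Literature.Claims.NS.Iotti2025

end
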